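import Summits.HodgeConjecture.HodgeConjecture.Theses.AnchorTransport
import Summits.HodgeConjecture.HodgeConjecture.Theorems.AnchorTransportVariationalHodgeReductions
import Summits.HodgeConjecture.HodgeConjecture.Theorems.AnchorTransportVariationalHodgeDominance
import Summits.HodgeConjecture.HodgeConjecture.Theorems.AnchorTransportVariationalHodgeClosing
import Summits.HodgeConjecture.HodgeConjecture.Theorems.AnchorTransportVariationalHodgeQuasiProjective
import HarnessLib

/-!
# Route AnchorTransport — `VariationalHodge` (stmt-HodgeConjecture-1076), line `exact-reduced-dimension-transport`: stub `stub_dominanceForm` (helpers)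

The registered stub `stub_dominanceForm` of the line skeleton
`Cruxes/VariationalHodge/Lines/exact_reduced_dimension_transport.lean` is the DOMINANCE FORM of the
variational Hodge statement over smooth irreducible affine bases: for a smooth projective family
`f : 𝒳 ⟶ S` (`Motives.IsSmoothProjectiveFamily`: smooth, proper, smooth projective geometrically
irreducible fibres — the total space is NOT assumed quasi-projective) over a smooth irreducible affine
`ℂ`-scheme `S` and a global class `A ∈ H²ᵖ(𝒳(ℂ); ℂ)`, algebraicity of `A|_{𝒳_t}` at all complex
points `t` over a non-empty Zariski open `U ⊆ S` implies algebraicity at every complex point.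

The stub is unconditional and cannot be closed today: its only available engine is the structure
theorem on algebraicity loci (the named fact `charlesSchnell_algebraicityLocus_iUnion_closed`:
countably many Zariski-closed `W_j ⊆ S` with locus `⋃ W_j(ℂ)`; unproved in the tree — reduced to
Mumford's curve lemma and Verdier's generic topological triviality of pairs by
`charlesSchnell_algebraicityLocus_iUnion_closed_of_mumford_of_verdier`), which moreover wants the
total space `𝒳` quasi-projective. This file lands the honest conditional forms:

* `dominanceForm_of_isQuasiProjectiveOver` — **the stub with the single extra hypothesis
  `IsQuasiProjectiveOver 𝒳`, granted ONLY the Charles–Schnell fact** (no Mumford lemma, unlike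
  `variationalHodge_dominance_of_open` of `AnchorTransportVariationalHodgeDominance`): the complex
  points over the non-empty Zariski open `U` form a non-empty open subset of `S(ℂ)` in the analytic
  topology (`AlgPoints.continuous_pt`, `exists_complexPoints_pt_mem_of_isOpen`), the affine base of
  finite type is quasi-projective (`IsQuasiProjectiveOver.of_isAffine`), and the local-to-global
  form `variationalHodge_conclusion_of_isOpen` (Baire category on `S(ℂ)` + irreducibility: a proper
  Zariski-closed subset has nowhere dense complex points, so a `W_j` containing the open set is `S`)
  concludes;
* `dominanceForm_of_isClosedImmersion` — the same for families projective in Hartshorne's sense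
  (`𝒳 ↪ ℙᴺ × S` closed; then `𝒳` is quasi-projective, `S` being affine:
  `isQuasiProjectiveOver_of_isClosedImmersion_of_isAffine`) — `variationalHodge_dominance_of_open`
  WITHOUT Mumford's lemma;
* `dominanceForm_of_isQuasiProjectiveOver_of_irreducible` — the same over EVERY smooth irreducible
  base (restriction to an affine open through the target point, which meets `U`; quasi-projectivity
  of the total space is stable under restriction to an open of the base,
  `isQuasiProjectiveOver_familyPullback`);
* `dominanceForm_of_quasiProjectiveTotalSpaces` — **the registered stub VERBATIM follows from the
  Charles–Schnell fact and the residual predicate `hqp`** (total spaces of smooth projective families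
  over smooth irreducible affine bases are quasi-projective — false in general, Atiyah-flop families;
  the same residual as in `variationalHodge_of_projective_of_isQuasiProjectiveOver`): the exact
  distance between the stub and the tree.
-/

noncomputable section

-- every declaration of this problem lives in `Summit.HodgeConjecture.HodgeConjecture.…` (summit = sub-problem)
set_option linter.dupNamespace false

open CategoryTheory AlgebraicGeometry TopologicalSpace MonoidalCategory
open Literature.AlgebraicGeometry.Motives Literature.AlgebraicGeometry.HodgeTheory

namespace Summit.HodgeConjecture.HodgeConjecture.Theorems

/-- **Dominance form of the variational Hodge statement for quasi-projective total spaces over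
smooth irreducible affine bases, granted only the Charles–Schnell fact.** Let `f : 𝒳 ⟶ S` be a smooth
projective family of relative dimension `n` with `𝒳` quasi-projective over `ℂ`, over a smooth
irreducible affine `ℂ`-scheme `S`, and `A ∈ H²ᵖ(𝒳(ℂ); ℂ)`. If `A|_{𝒳_t}` is algebraic for every complex
point `t` over a non-empty Zariski open `U ⊆ S`, then it is algebraic at EVERY complex point `t`.
Proof: `S` is quasi-projective (affine of finite type); the complex points over `U` form a non-empty
(`exists_complexPoints_pt_mem_of_isOpen`: Jacobson + Nullstellensatz) open subset of `S(ℂ)` in the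
analytic topology (`AlgPoints.continuous_pt`); the algebraicity locus is `⋃ⱼ Wⱼ(ℂ)` for countably many
Zariski-closed `Wⱼ` (the fact), and a `Wⱼ ≠ S` has nowhere dense complex points in the Baire space
`S(ℂ)`, so some `Wⱼ = S` (`variationalHodge_conclusion_of_isOpen`). No curve lemma is used.
[cite: CharlesSchnell2014Notes, Prop. 11.3.11 (proof)]
[cite: VoisinHodgeII2003, §7.3.2, proof of Thm. 7.19] -/
theorem dominanceForm_of_isQuasiProjectiveOver :
    charlesSchnell_algebraicityLocus_iUnion_closed →
    ∀ ⦃n : ℕ⦄ ⦃𝒳 S : SchemeOver ℂ⦄ (f : 𝒳 ⟶ S), IsSmoothProjectiveFamily f n →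
      IsQuasiProjectiveOver 𝒳 →
      IrreducibleSpace S.left → IsAffine S.left → AlgebraicGeometry.Smooth S.hom →
      ∀ (p : ℕ) (A : complexBetti 𝒳 (2 * p)) (U : Set S.left), IsOpen U → U.Nonempty →
      (∀ t : ComplexPoints S, t.pt ∈ U →
        complexBetti.map (fiberι f t) (2 * p) A ∈ algebraicClasses (fiberOver f t) p) →
      ∀ t : ComplexPoints S,
        complexBetti.map (fiberι f t) (2 * p) A ∈ algebraicClasses (fiberOver f t) p := by
  intro hCS n 𝒳 S f hf h𝒳 hirr haff hsm p A U hU hUne halg t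
  haveI := haff
  haveI := hsm
  have hS : IsQuasiProjectiveOver S := IsQuasiProjectiveOver.of_isAffine S
  -- a complex point over `U`: the analytic open `{t | pt t ∈ U}` of `S(ℂ)` is non-empty
  obtain ⟨u, hu⟩ := exists_complexPoints_pt_mem_of_isOpen hU hUne
  exact variationalHodge_conclusion_of_isOpen f hCS h𝒳 hS hsm hirr hf A
    (hU.preimage AlgPoints.continuous_pt) ⟨u, hu⟩ (fun s hs => halg s hs) t

/-- **Dominance form for families projective in Hartshorne's sense over smooth irreducible affine
bases, granted only the Charles–Schnell fact** (`variationalHodge_dominance_of_open` without Mumford's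
lemma): a closed `S`-immersion `𝒳 ↪ ℙᴺ × S` over the affine `S` makes `𝒳` quasi-projective
(`isQuasiProjectiveOver_of_isClosedImmersion_of_isAffine`), and
`dominanceForm_of_isQuasiProjectiveOver` applies. [cite: CharlesSchnell2014Notes, Prop. 11.3.11 (proof)]
[cite: VoisinHodgeII2003, §7.3.2, proof of Thm. 7.19] -/
theorem dominanceForm_of_isClosedImmersion (hCS : charlesSchnell_algebraicityLocus_iUnion_closed)
    {n p : ℕ} {𝒳 S : SchemeOver ℂ} (f : 𝒳 ⟶ S) (hf : IsSmoothProjectiveFamily f n)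
    (hι : ∃ (N : ℕ) (ι : 𝒳 ⟶ projectiveSpace N ℂ ⊗ S), IsClosedImmersion ι.left ∧
      ι ≫ CartesianMonoidalCategory.snd (projectiveSpace N ℂ) S = f)
    [IsAffine S.left] [IrreducibleSpace S.left] [AlgebraicGeometry.Smooth S.hom]
    (A : complexBetti 𝒳 (2 * p)) {U : Set S.left} (hU : IsOpen U) (hUne : U.Nonempty)
    (halg : ∀ t : ComplexPoints S, t.pt ∈ U →
      complexBetti.map (fiberι f t) (2 * p) A ∈ algebraicClasses (fiberOver f t) p)
    (t : ComplexPoints S) :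
    complexBetti.map (fiberι f t) (2 * p) A ∈ algebraicClasses (fiberOver f t) p :=
  dominanceForm_of_isQuasiProjectiveOver hCS f hf
    (isQuasiProjectiveOver_of_isClosedImmersion_of_isAffine hι) ‹_› ‹_› ‹_› p A U hU hUne halg t

/-- **Dominance form for quasi-projective total spaces over EVERY smooth irreducible base, granted
only the Charles–Schnell fact.** Reduction to the affine case `dominanceForm_of_isQuasiProjectiveOver`:
the point `pt t` lies in an affine open `W ⊆ S`, which meets `U` (`S` is irreducible); restrict the
family to `W` (`Motives.openSubschemeOver`, a smooth irreducible affine `ℂ`-scheme; the restriction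
is the base change along the open immersion `W ⟶ S`, whose total space stays quasi-projective,
`isQuasiProjectiveOver_familyPullback`), lift `t` to `W` (`AlgPoints.liftOfMemOpensRange`), use
algebraicity over the non-empty open `U ∩ W` of `W`, and move the conclusion back
(`familyPullback_map_fiberι_mem_algebraicClasses_iff`). Neither separatedness nor quasi-compactness
of `S` is needed. [cite: CharlesSchnell2014Notes, Prop. 11.3.11 (proof)]
[cite: VoisinHodgeII2003, §7.3.2, proof of Thm. 7.19] -/
theorem dominanceForm_of_isQuasiProjectiveOver_of_irreducible
    (hCS : charlesSchnell_algebraicityLocus_iUnion_closed) {n p : ℕ} {𝒳 S : SchemeOver ℂ}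
    (f : 𝒳 ⟶ S) (hf : IsSmoothProjectiveFamily f n) (h𝒳 : IsQuasiProjectiveOver 𝒳)
    [IrreducibleSpace S.left] [AlgebraicGeometry.Smooth S.hom]
    (A : complexBetti 𝒳 (2 * p)) {U : Set S.left} (hU : IsOpen U) (hUne : U.Nonempty)
    (halg : ∀ t : ComplexPoints S, t.pt ∈ U →
      complexBetti.map (fiberι f t) (2 * p) A ∈ algebraicClasses (fiberOver f t) p)
    (t : ComplexPoints S) :
    complexBetti.map (fiberι f t) (2 * p) A ∈ algebraicClasses (fiberOver f t) p := by
  -- an affine open `W ∋ pt t`; it meets `U`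
  obtain ⟨W, hW, htW, -⟩ := exists_isAffineOpen_mem_and_subset (U := ⊤) (x := t.pt) trivial
  have hWU : ((W : Set S.left) ∩ U).Nonempty := by
    obtain ⟨x, -, hxW, hxU⟩ := (PreirreducibleSpace.isPreirreducible_univ (X := S.left)) _ _
      W.isOpen hU ⟨t.pt, Set.mem_univ _, htW⟩ (let ⟨u, hu⟩ := hUne; ⟨u, Set.mem_univ _, hu⟩)
    exact ⟨x, hxW, hxU⟩
  -- the open subscheme `W` as a smooth irreducible affine `ℂ`-scheme `g : W ⟶ S`
  set g := openSubschemeOverι S W with hg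
  haveI hgo : IsOpenImmersion g.left := inferInstanceAs (IsOpenImmersion W.ι)
  have hWaff : IsAffine (openSubschemeOver S W).left := hW
  have hWirr : IrreducibleSpace (openSubschemeOver S W).left := by
    change IrreducibleSpace W
    exact isIrreducible_iff_irreducibleSpace.mp ⟨⟨t.pt, htW⟩,
      (PreirreducibleSpace.isPreirreducible_univ (X := S.left)).open_subset W.isOpen
        (Set.subset_univ _)⟩
  have hWsm : AlgebraicGeometry.Smooth (openSubschemeOver S W).hom := by
    change AlgebraicGeometry.Smooth (W.ι ≫ S.hom)
    infer_instance
  -- lift `t` to `W`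
  obtain ⟨t', rfl⟩ : ∃ t' : ComplexPoints (openSubschemeOver S W), AlgPoints.map g t' = t :=
    ⟨AlgPoints.liftOfMemOpensRange g t ⟨⟨t.pt, htW⟩, rfl⟩, AlgPoints.map_liftOfMemOpensRange g t _⟩
  -- base change to `W` (quasi-projective total space) and the affine dominance over `W ∩ U`
  have hU' : IsOpen (g.left.base ⁻¹' U) := hU.preimage g.left.base.hom.continuous
  have hU'ne : (g.left.base ⁻¹' U).Nonempty := by
    obtain ⟨x, hxW, hxU⟩ := hWU
    exact ⟨⟨x, hxW⟩, hxU⟩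
  rw [← familyPullback_map_fiberι_mem_algebraicClasses_iff f g hf A t']
  exact dominanceForm_of_isQuasiProjectiveOver hCS (familyPullback.snd f g) (hf.familyPullback_snd g)
    (isQuasiProjectiveOver_familyPullback f g hgo h𝒳) hWirr hWaff hWsm p
    (complexBetti.map (familyPullback.fst f g) (2 * p) A) (g.left.base ⁻¹' U) hU' hU'ne
    (fun c hc => (familyPullback_map_fiberι_mem_algebraicClasses_iff f g hf A c).2
      (halg (AlgPoints.map g c) hc)) t'

/-- **The registered stub `stub_dominanceForm` verbatim, from the Charles–Schnell fact and the
residual predicate `hqp`** (quasi-projectivity of the total space of every smooth projective family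
over a smooth irreducible affine base — NOT a theorem: the mixed small resolution of a two-nodal
quartic pencil is a smooth proper family of K3 surfaces over a smooth affine curve whose total space
is not quasi-projective; it is the same residual as in
`variationalHodge_of_projective_of_isQuasiProjectiveOver`). This records the exact distance between
the stub and the tree: the fact (relative Hilbert schemes, or Verdier's generic triviality of pairs
plus Mumford's curve lemma, `charlesSchnell_algebraicityLocus_iUnion_closed_of_mumford_of_verdier`)
and the proper-not-projective case. [cite: CharlesSchnell2014Notes, Prop. 11.3.11 (proof)]
[cite: VoisinHodgeII2003, §7.3.2, proof of Thm. 7.19] -/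
theorem dominanceForm_of_quasiProjectiveTotalSpaces
    (hCS : charlesSchnell_algebraicityLocus_iUnion_closed)
    (hqp : ∀ ⦃n : ℕ⦄ ⦃𝒳 S : SchemeOver ℂ⦄ (f : 𝒳 ⟶ S), IsSmoothProjectiveFamily f n →
      IrreducibleSpace S.left → IsAffine S.left → AlgebraicGeometry.Smooth S.hom →
      IsQuasiProjectiveOver 𝒳) :
    ∀ ⦃n : ℕ⦄ ⦃𝒳 S : SchemeOver ℂ⦄ (f : 𝒳 ⟶ S), IsSmoothProjectiveFamily f n →
      IrreducibleSpace S.left → IsAffine S.left → AlgebraicGeometry.Smooth S.hom →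
      ∀ (p : ℕ) (A : complexBetti 𝒳 (2 * p)) (U : Set S.left), IsOpen U → U.Nonempty →
      (∀ t : ComplexPoints S, t.pt ∈ U →
        complexBetti.map (fiberι f t) (2 * p) A ∈ algebraicClasses (fiberOver f t) p) →
      ∀ t : ComplexPoints S,
        complexBetti.map (fiberι f t) (2 * p) A ∈ algebraicClasses (fiberOver f t) p :=
  fun _ _ _ f hf hirr haff hsm p A U hU hUne halg t =>
    dominanceForm_of_isQuasiProjectiveOver hCS f hf (hqp f hf hirr haff hsm) hirr haff hsm p A U hU
      hUne halg t

end Summit.HodgeConjecture.HodgeConjecture.Theorems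

end
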